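import Summits.CriticalPhenomena.PercolationContinuityZ3.Theorems.PercNearOneGluingNoHeavyLowerTailSahiSlotTensorConeOrderTwo

/-!
# The lattice of literal-certificate formats: pinning MORE members is WEAKER —
# `LitProdCert d (n+3) → PinnedLitCert d (n+2) → PairLitCert d (n+1) → SlotPatternPos d (n+3)`

Support file of the one-cut programme (crux `NoHeavyLowerTail`, stmt-CriticalPhenomena-4575; cell `prim-masterthm`, seat P3, gen 22;
`run/shared/lean/prim/prim-masterthm/prim-masterthm-p3/HIERARCHY.md` §30).  Pure proof, no definitions, standard axioms.

The three certificate formats of the slot functional `patternForm d m` (gens 20–22): `LitProdCert d m` (every member through one literal),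
`PinnedLitCert d (m−1)` (member 0 pinned, the others through one literal each), `PairLitCert d (m−2)` (all but the last two pinned).  The tree has
`pinnedLitCert_of_litProdCert` (global ⟹ pinned-one) and the two soundness theorems.  THIS FILE closes the chain:
**`pairLitCert_of_pinnedLitCert : PinnedLitCert d (n+2) → PairLitCert d (n+1)`** (order `n + 3`): from a pinned-one certificate, pin the next `n` members as
well by absorbing their (nonnegative, constant) literal values into the coefficients — so at every order ≥ 3 the formats are nested
`LitProd ⟹ Pinned ⟹ Pair ⟹ positivity` (`litProdCert_chain`).  (At order 2 the chain degenerates: `PairLitCert d 0` pins nothing and is `LitProdCert d 2`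
restricted to cut edges — both theorems of `…SahiSlotTensorConeOrderTwo`.  For `d ≤ 2` the order-3 instance `PairLitCert d 1` follows from the
computational `litProdCert_two_three` through the chain; not restated here to keep this file pure.)
HONEST LABEL: bookkeeping between formats; no cell is proved here. [this work]
-/

noncomputable section

namespace Summit.CriticalPhenomena.PercolationContinuityZ3.Theorems

open Finset Function
open Literature.Combinatorics.Sahi2008

namespace SahiSlot

section Chain

variable {d n : ℕ}

/-- The `pairFam` of `A, B, C` is `Fin.cons (A 0)` of the family `(A 1, …, A n, B, C)`. [this work] -/
theorem pairFam_eq_cons (A : Fin (n + 1) → Q d (n + 3) → ℝ) (B C : Q d (n + 3) → ℝ) :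
    pairFam A B C = Fin.cons (A 0) (Fin.snoc (Fin.snoc (Fin.tail A) B) C) := by
  unfold pairFam
  rw [Fin.cons_snoc_eq_snoc_cons, Fin.cons_snoc_eq_snoc_cons, Fin.cons_self_tail]

/-- **Pinning more members is weaker**: a pinned-one certificate at order `n + 3` yields an all-but-two-pinned certificate at the same order.
[this work] -/
theorem pairLitCert_of_pinnedLitCert (h : PinnedLitCert d (n + 2)) : PairLitCert d (n + 1) := by
  intro A hA
  obtain ⟨k, coef, J, hcoef, hid⟩ := h (A 0) (hA 0)
  -- absorb the literal values of the pinned members `A 1, …, A n` (positions `0, …, n-1` of the pinned-one family)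
  refine ⟨k, fun j => coef j * ∏ i : Fin n, (J j (Fin.castSucc (Fin.castSucc i))).eval (setInd (A i.succ)),
    fun j => J j (Fin.castSucc (Fin.last n)), fun j => J j (Fin.last (n + 1)),
    fun j => mul_nonneg (hcoef j) (prod_nonneg fun i _ => Lit.eval_setInd_nonneg _ (hA _) _), fun B C hB hC => ?_⟩
  -- the family seen by the pinned-one certificate
  let U : Fin (n + 2) → Finset (Q d (n + 3)) := Fin.snoc (Fin.snoc (fun i : Fin n => A i.succ) B) C
  have hU : ∀ i, IsUpperSet ((U i : Finset (Q d (n + 3))) : Set (Q d (n + 3))) := by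
    intro i
    refine Fin.lastCases ?_ (fun i' => ?_) i
    · show IsUpperSet (((Fin.snoc (Fin.snoc (fun i : Fin n => A i.succ) B) C : Fin (n + 2) → Finset (Q d (n + 3))) (Fin.last (n + 1)) :
        Finset (Q d (n + 3))) : Set (Q d (n + 3)))
      rw [Fin.snoc_last]; exact hC
    · show IsUpperSet (((Fin.snoc (Fin.snoc (fun i : Fin n => A i.succ) B) C : Fin (n + 2) → Finset (Q d (n + 3))) (Fin.castSucc i') :
        Finset (Q d (n + 3))) : Set (Q d (n + 3)))
      rw [Fin.snoc_castSucc]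
      refine Fin.lastCases ?_ (fun i'' => ?_) i'
      · rw [Fin.snoc_last]; exact hB
      · rw [Fin.snoc_castSucc]; exact hA _
  have hfam : pairFam (fun i => setInd (A i)) (setInd B) (setInd C) = Fin.cons (setInd (A 0)) (fun i => setInd (U i)) := by
    rw [pairFam_eq_cons]
    congr 1
    funext i
    refine Fin.lastCases ?_ (fun i' => ?_) i
    · simp only [U, Fin.snoc_last]
    · simp only [U, Fin.snoc_castSucc]
      refine Fin.lastCases ?_ (fun i'' => ?_) i'
      · simp only [Fin.snoc_last]
      · simp only [Fin.snoc_castSucc, Fin.tail]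
  rw [hfam, hid U hU]
  refine sum_congr rfl fun j _ => ?_
  rw [Fin.prod_univ_castSucc, Fin.prod_univ_castSucc]
  have hUB : U (Fin.castSucc (Fin.last n)) = B := by simp only [U, Fin.snoc_castSucc, Fin.snoc_last]
  have hUC : U (Fin.last (n + 1)) = C := by simp only [U, Fin.snoc_last]
  have hUA : ∀ i : Fin n, U (Fin.castSucc (Fin.castSucc i)) = A i.succ := fun i => by simp only [U, Fin.snoc_castSucc]
  simp only [hUB, hUC, hUA]
  ring

/-- **The chain of formats at every order `≥ 3`**: `LitProdCert d (n+3) → PinnedLitCert d (n+2) → PairLitCert d (n+1) → SlotPatternPos d (n+3)`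
(the three implications of the tree composed). [this work] -/
theorem litProdCert_chain :
    (LitProdCert d (n + 3) → PinnedLitCert d (n + 2)) ∧ (PinnedLitCert d (n + 2) → PairLitCert d (n + 1)) ∧
      (PairLitCert d (n + 1) → SlotPatternPos d (n + 3)) :=
  ⟨pinnedLitCert_of_litProdCert, pairLitCert_of_pinnedLitCert, slotPatternPos_of_pairLitCert⟩

/-- In particular at order 3: the pivotal-pair format `PairLitCert d 1` follows from the pinned-one format `PinnedLitCert d 2` (they pin the same
member; recorded so that the order-3 conjecture can be quoted in either vocabulary). [this work] -/
theorem pairLitCert_one_of_pinnedLitCert_two (h : PinnedLitCert d 2) : PairLitCert d 1 := pairLitCert_of_pinnedLitCert h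

end Chain

end SahiSlot

end Summit.CriticalPhenomena.PercolationContinuityZ3.Theorems
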